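import Summits.ResolutionOfSingularities.ResolutionOfSingularities.Theorems.WildConesAssembly
import Summits.ResolutionOfSingularities.ResolutionOfSingularities.Theorems.WildConesClassicalRegimes

/-!
# Target `IsolatedForcedTermination` (stmt-ResolutionOfSingularities-16343) — PROVED
# (routes `FrobeniusClosing`, `WildCones`, `JacobianBudget`, `EscapeRate`: the shared rank-0 target)

For every prime `p`, every `n ≥ 1` and every perfect field `κ` of characteristic `p`: no start
coefficient function, chart word and translation word make EVERY state of the point-blow-up dynamics
of the height-one atom `z^p = a(u₁, …, uₙ)` (blow up the closed point, divide by `u_i^p`, translate to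
the new closed point, delete `p`-th-power monomials) isolated of multiplicity `p`. In words: an
isolated `p`-fold point of a purely inseparable height-one hypersurface cannot have an infinite chain
of isolated `p`-fold infinitely near points — the forced-centre core of the termination problem.

Assembly: the ENGINE of route `WildCones` (`Theorems/WildConesAssembly.lean`, p455468:
`ConeExit → NarrowRunsDie → ClassicalRegimes → IsolatedForcedTermination`, with `ConeExit_proof` and
`NarrowRunsDie_proof` theorems of the tree) applied to `ClassicalRegimes_proof`
(`Theorems/WildConesClassicalRegimes.lean`). The four route files inline the same `let`-calculus, so
the four copies of the target agree definitionally (`Iff.rfl` bridges in `WildConesAssembly`).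

Everything here is OURS (campaign res-hironaka, rung L, slot W4.1, chain w41); it replaces the role of
no printed item and is NOT a statement of Hironaka's manuscript.
-/

noncomputable section

-- single-problem summit: the doubled namespace component is forced by the tree layout
set_option linter.dupNamespace false

namespace Summit.ResolutionOfSingularities.ResolutionOfSingularities.Theorems.WildCones

/-- **THE TARGET `FrobeniusClosing.IsolatedForcedTermination` (stmt-ResolutionOfSingularities-16343),
PROVED**: no infinite run of the point-blow-up dynamics of a height-one atom over a perfect field has
every state isolated of multiplicity `p`. The WildCones engine applied to `ClassicalRegimes_proof`.
OURS; NOT a statement of Hironaka's manuscript. [cite: HauserPerlega2019, §1 p. 3 and §5] -/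
theorem IsolatedForcedTermination_proof : Theses.FrobeniusClosing.IsolatedForcedTermination :=
  frobeniusClosing_isolatedForcedTermination_of_classicalRegimes ClassicalRegimes_proof

end Summit.ResolutionOfSingularities.ResolutionOfSingularities.Theorems.WildCones

end
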